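import Summits.SmoothPoincare4.SmoothPoincare4.Theses.SymplecticOrigami
import Summits.SmoothPoincare4.SmoothPoincare4.Theses.SymplecticCap
import Summits.SmoothPoincare4.SmoothPoincare4.Theorems.SymplecticOrigamiGromovRecognitionRelEndStubEndDoesNotReturn
import Summits.SmoothPoincare4.SmoothPoincare4.Theorems.SymplecticOrigamiGromovRecognitionRelEndStubTameJ
import Summits.SmoothPoincare4.SmoothPoincare4.Theorems.SymplecticOrigamiGromovRecognitionRelEndStubCapModel
import Summits.SmoothPoincare4.SmoothPoincare4.Theorems.SymplecticOrigamiGromovRecognitionRelEndStubFlatCutoff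
import Summits.SmoothPoincare4.SmoothPoincare4.Theorems.SymplecticOrigamiGromovRecognitionRelEndStubTameMoser
import Summits.SmoothPoincare4.SmoothPoincare4.Theorems.SymplecticOrigamiGromovRecognitionRelEndStubWedgeDisjoint
import Summits.SmoothPoincare4.SmoothPoincare4.Theorems.SymplecticOrigamiGromovRecognitionRelEndStubSphereDetVanishes
import Summits.SmoothPoincare4.SmoothPoincare4.Theorems.SymplecticOrigamiGromovRecognitionRelEndStubFlatLeaves
import Summits.SmoothPoincare4.SmoothPoincare4.Theorems.SymplecticOrigamiGromovRecognitionRelEndStubReadSigma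
import Summits.SmoothPoincare4.SmoothPoincare4.Theorems.SymplecticOrigamiGromovRecognitionRelEndStubPositiveHolonomy
import Summits.SmoothPoincare4.SmoothPoincare4.Theorems.SymplecticOrigamiGromovRecognitionRelEndStubFactPositivity
import Summits.SmoothPoincare4.SmoothPoincare4.Theorems.SymplecticOrigamiGromovRecognitionRelEndStubFactCountHomological
import Summits.SmoothPoincare4.SmoothPoincare4.Theorems.SymplecticOrigamiGromovRecognitionRelEndStubFactIndexHomological
import Summits.SmoothPoincare4.SmoothPoincare4.Theorems.SymplecticOrigamiGromovRecognitionRelEndStubCoreGlue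

/-!
# The crux `GromovRecognitionRelEnd` FROM THE THREE REMAINING FACTS (line `cross-cap-laurent`,
item stmt-SmoothPoincare4-11009) — the line's composition as a landed CONDITIONAL theorem

`GromovRecognitionRelEnd_of_facts : F1 → F2 → F4 → SymplecticOrigami.GromovRecognitionRelEnd` (registered as
`helper_cruxOfFacts`; and the SymplecticCap copy), where F1 = `hls_localFoliation_embeddedSphere_trivialNormal` (= crux
stmt-SmoothPoincare4-16778 `LocalFoliationEmbeddedSpheres`), F2 = `gromovCompactness_spheres_dichotomy`
(= crux stmt-16777 `GromovCompactnessSpheres`), F4 = `adjunction_embedded_of_somewhereInjective_sphere`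
(= crux stmt-16775 `AdjunctionEmbeddedSpheres`).  This is the skeleton `Lines/cross_cap_laurent.lean`
with every in-line stub replaced by its LANDED theorem (`stub_endDoesNotReturn`, `stub_tameJ`,
`stub_capModel`, `stub_coreGlue` — the glue over the six vendored facts, three of which are now proved in
Literature: `stub_factPositivity`, `stub_factCountHomological`, `stub_factIndexHomological` —,
`stub_positiveHolonomy`, `stub_wedgeDisjoint`, `stub_flatLeaves`, `stub_sphereDetVanishes`,
`stub_readSigma`, `stub_flatCutoff`, `stub_tameMoser`) and the three open facts as HYPOTHESES: the exact
assembly `GromovRecognitionRelEnd ⇐ 16775 ∧ 16778 ∧ 16777` the planners' split asks for.  No new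
definitions; the local notations `E4`, `E2` are those of the skeleton.
-/

noncomputable section

-- the prescribed namespace `Summit.<P>.<Sub>.…` duplicates `SmoothPoincare4` (P = Sub)
set_option linter.dupNamespace false

open scoped Manifold ContDiff Topology
open Set TopologicalSpace Literature.Geometry.Kaehler Literature.Geometry.Symplectic

namespace Summit.SmoothPoincare4.SmoothPoincare4.Theorems.GromovRecognitionRelEnd.CrossCapLaurent

/-- Model space `ℝ⁴ = ℂ²` (coordinates `0,1` = `z₁`, `2,3` = `z₂`). -/
local notation "E4" => EuclideanSpace ℝ (Fin 4)
/-- `ℝ² = ℂ`, the coordinate plane of one factor. -/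
local notation "E2" => EuclideanSpace ℝ (Fin 2)

/-- **Stub 4b — THE CORE (XL): the two `J`-holomorphic fibrations of the capped manifold, chart-free
(Gromov 1985, 2.4.A₁′ p. 337 read on `X`; Wendl 2018, proof of Thm 6.8, pp. 138–139 for the NON-generic
`J₀`; McDuff–Salamon 2017 Rem. 4.5.2 (v) p. 192; McDuff 1990).**  For the wedge cap `(X, ωX, JX)` of
`(M, J)` (cap block of `stub_capModel`: `JX` tamed by the closed `ωX`, `H∞ = ηH(ℂ × 0) ∪ {ηC 0}` and
`V∞ = ηV(0 × ℂ) ∪ {ηC 0}` embedded `JX`-spheres with trivial normal bundles meeting once, transversally, at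
the corner, `X ∖ (H∞ ∪ V∞) = ι(M)` with `π₂(M) = 0`) there are two `C^∞` maps `lamV lamH : X → X` —
`lamV y` = the point where the `V`-LEAF through `y` (the unique embedded `JX`-sphere of the family of `V∞`
through `y`) meets `H∞`, `lamH y` = the point where the `H`-leaf through `y` meets `V∞` — such that:
`lamV` retracts `X` onto `H∞` and `lamH` onto `V∞`; the leaves through the corner are `V∞` and `H∞`
(`lamV y = ηC 0 ↔ y ∈ V∞`); `(lamV, lamH) : X → H∞ × V∞` is a bijection (every `V`-leaf meets every
`H`-leaf exactly once); the kernels of `d lamV`, `d lamH` are `JX`-invariant (the leaves are `JX`-curves)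
and transversal.  (Positivity of the holonomy — the complex structure transported along a leaf to `T H∞`
is oriented like `JX|TH∞` — is a CONSEQUENCE, split off as the soft `stub_positiveHolonomy` below; what is
left here is exactly Gromov's "two transversal fibrations into rational `J`-curves with `S₁`, `S₂` as
fibres" in retraction form.)  HYPOTHESES TRIMMED (lead c1, 21:10Z) to what the statement is about: the
cap block, `π₂(M) = 0` and `0 < R₁`; the end chart `ψ`, `K`, `R` and `J = ψ^*(i ⊕ i)` do not occur (they only
served to BUILD the cap in `stub_capModel`).
Proof plan = Wendl pp. 138–139 made relative and non-generic: (a) `H∞`, `V∞` are embedded `JX`-spheres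
with `c_N = 0` (read in the cap charts, where `JX = i ⊕ i`); (b) automatic transversality for embedded
index-2 spheres (Hofer–Lizan–Sikorav; Wendl Thm 2.44/2.46, Prop. 2.53): nearby embedded `JX`-spheres
foliate a neighbourhood, smooth 2-dimensional moduli spaces `𝓜_H ∋ H∞`, `𝓜_V ∋ V∞`; (c) COMPACTNESS
with no genericity and no area condition: spherical classes of `X` are `k[H] + m[V]` (universal cover +
Hurewicz, `π₂(M) = 0` used HERE ONLY), a Gromov limit of `[V]`-spheres has components with
`(·H∞, ·V∞) = (kᵢ, mᵢ) ≥ 0` by positivity against the `JX`-holomorphic `H∞`, `V∞` (covers included),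
`Σ kᵢ = 1`, `Σ mᵢ = 0` ⇒ one simple embedded component (adjunction), the rest constant — Gromov
compactness (Hummel 1997) + positivity of intersections (McDuff, Micallef–White; Wendl 2.49/2.51);
(d) open–closed on the connected `X`: the leaves of each family foliate `X`; `[H]·[V] = 1` + positivity:
every `V`-leaf meets every `H`-leaf once transversally, so `lamV`, `lamH` are well defined, smooth
(evaluation maps are diffeomorphisms), jointly bijective; (e) kernels = tangent planes of the leaves
(`JX`-complex), positivity of the holonomy by continuity from `H∞`.  Formal cost: Fredholm theory,
Gromov compactness, positivity of intersections/adjunction, smooth structures on moduli spaces,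
Whitney approximation (to use the continuous `π₂` hypothesis on smooth spheres) — none of it in Mathlib:
this is the honest XL residue of the crux (promote candidate).  NOT a restatement of the crux: no
symplectic form, no `ψ`, no diffeomorphism to `ℝ⁴` in the conclusion.
[cite: Gromov1985, 2.4.A₁′; Wendl2018, proof of Thm 6.8; McDuffSalamon2017, Rem. 4.5.2 (v)] -/
theorem biFoliationCore_of_facts
    (hF1 : Literature.Geometry.Symplectic.hls_localFoliation_embeddedSphere_trivialNormal)
    (hF2 : Literature.Geometry.Symplectic.gromovCompactness_spheres_dichotomy)
    (hF4 : Literature.Geometry.Symplectic.adjunction_embedded_of_somewhereInjective_sphere) :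
    ∀ (M : Type) [TopologicalSpace M] [T2Space M] [SecondCountableTopology M]
      [ChartedSpace E4 M] [IsManifold (𝓡 4) ∞ M] [ConnectedSpace M]
      (J : AlmostComplexStructure (𝓡 4) ∞ M) (R₁ : ℝ) (χ : E4 → M),
      (∀ x : M, Subsingleton (π_ 2 M x)) →
      0 < R₁ →
      ∀ (X : Type) [TopologicalSpace X] [T2Space X] [SecondCountableTopology X] [CompactSpace X]
        [ConnectedSpace X] [ChartedSpace E4 X] [IsManifold (𝓡 4) ∞ X]
        (ωX : MForm (𝓡 4) X ℝ 2) (JX : AlmostComplexStructure (𝓡 4) ∞ X) (ι : M → X)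
        (ηH ηV ηC : E4 → X),
        (IsSmoothForm ωX ∧ IsClosedForm ωX ∧ JX.IsTamedBy ωX) ∧
        (IsLocalDiffeomorph (𝓡 4) (𝓡 4) ∞ ι ∧ Function.Injective ι ∧
          ∀ (x : M) (v : TangentSpace (𝓡 4) x),
            JX (ι x) (mfderiv (𝓡 4) (𝓡 4) ι x v) = mfderiv (𝓡 4) (𝓡 4) ι x (J x v)) ∧
        (IsLocalDiffeomorphOn 𝓘(ℝ, E4) (𝓡 4) ∞ ηV {p : E4 | p 0 ^ 2 + p 1 ^ 2 < R₁⁻¹ ^ 2} ∧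
          Set.InjOn ηV {p : E4 | p 0 ^ 2 + p 1 ^ 2 < R₁⁻¹ ^ 2} ∧
          (∀ p : E4, p 0 ^ 2 + p 1 ^ 2 < R₁⁻¹ ^ 2 → (p 0 ≠ 0 ∨ p 1 ≠ 0) →
            ηV p = ι (χ (WithLp.toLp 2
              ![p 0 / (p 0 ^ 2 + p 1 ^ 2), -(p 1) / (p 0 ^ 2 + p 1 ^ 2), p 2, p 3]))) ∧
          (∀ p : E4, p 0 = 0 → p 1 = 0 → ηV p ∉ Set.range ι) ∧
          (∀ p : E4, p 0 ^ 2 + p 1 ^ 2 < R₁⁻¹ ^ 2 → ∀ q : E4,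
            JX (ηV p) (mfderiv 𝓘(ℝ, E4) (𝓡 4) ηV p q) =
              mfderiv 𝓘(ℝ, E4) (𝓡 4) ηV p (WithLp.toLp 2 ![-(q 1), q 0, -(q 3), q 2]))) ∧
        (IsLocalDiffeomorphOn 𝓘(ℝ, E4) (𝓡 4) ∞ ηH {p : E4 | p 2 ^ 2 + p 3 ^ 2 < R₁⁻¹ ^ 2} ∧
          Set.InjOn ηH {p : E4 | p 2 ^ 2 + p 3 ^ 2 < R₁⁻¹ ^ 2} ∧
          (∀ p : E4, p 2 ^ 2 + p 3 ^ 2 < R₁⁻¹ ^ 2 → (p 2 ≠ 0 ∨ p 3 ≠ 0) →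
            ηH p = ι (χ (WithLp.toLp 2
              ![p 0, p 1, p 2 / (p 2 ^ 2 + p 3 ^ 2), -(p 3) / (p 2 ^ 2 + p 3 ^ 2)]))) ∧
          (∀ p : E4, p 2 = 0 → p 3 = 0 → ηH p ∉ Set.range ι) ∧
          (∀ p : E4, p 2 ^ 2 + p 3 ^ 2 < R₁⁻¹ ^ 2 → ∀ q : E4,
            JX (ηH p) (mfderiv 𝓘(ℝ, E4) (𝓡 4) ηH p q) =
              mfderiv 𝓘(ℝ, E4) (𝓡 4) ηH p (WithLp.toLp 2 ![-(q 1), q 0, -(q 3), q 2]))) ∧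
        (IsLocalDiffeomorphOn 𝓘(ℝ, E4) (𝓡 4) ∞ ηC
            {p : E4 | p 0 ^ 2 + p 1 ^ 2 < R₁⁻¹ ^ 2 ∧ p 2 ^ 2 + p 3 ^ 2 < R₁⁻¹ ^ 2} ∧
          Set.InjOn ηC {p : E4 | p 0 ^ 2 + p 1 ^ 2 < R₁⁻¹ ^ 2 ∧ p 2 ^ 2 + p 3 ^ 2 < R₁⁻¹ ^ 2} ∧
          (∀ p : E4, p 0 ^ 2 + p 1 ^ 2 < R₁⁻¹ ^ 2 → p 2 ^ 2 + p 3 ^ 2 < R₁⁻¹ ^ 2 →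
            (p 2 ≠ 0 ∨ p 3 ≠ 0) →
            ηC p = ηV (WithLp.toLp 2
              ![p 0, p 1, p 2 / (p 2 ^ 2 + p 3 ^ 2), -(p 3) / (p 2 ^ 2 + p 3 ^ 2)])) ∧
          (∀ p : E4, p 0 ^ 2 + p 1 ^ 2 < R₁⁻¹ ^ 2 → p 2 ^ 2 + p 3 ^ 2 < R₁⁻¹ ^ 2 →
            (p 0 ≠ 0 ∨ p 1 ≠ 0) →
            ηC p = ηH (WithLp.toLp 2
              ![p 0 / (p 0 ^ 2 + p 1 ^ 2), -(p 1) / (p 0 ^ 2 + p 1 ^ 2), p 2, p 3])) ∧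
          ηC 0 ∉ Set.range ι ∧
          (∀ p : E4, p 0 ^ 2 + p 1 ^ 2 < R₁⁻¹ ^ 2 → p 2 ^ 2 + p 3 ^ 2 < R₁⁻¹ ^ 2 → ∀ q : E4,
            JX (ηC p) (mfderiv 𝓘(ℝ, E4) (𝓡 4) ηC p q) =
              mfderiv 𝓘(ℝ, E4) (𝓡 4) ηC p (WithLp.toLp 2 ![-(q 1), q 0, -(q 3), q 2]))) ∧
        (∀ y : X, y ∈ Set.range ι ∨ (∃ p : E4, p 0 ^ 2 + p 1 ^ 2 < R₁⁻¹ ^ 2 ∧ ηV p = y) ∨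
          (∃ p : E4, p 2 ^ 2 + p 3 ^ 2 < R₁⁻¹ ^ 2 ∧ ηH p = y) ∨
          (∃ p : E4, (p 0 ^ 2 + p 1 ^ 2 < R₁⁻¹ ^ 2 ∧ p 2 ^ 2 + p 3 ^ 2 < R₁⁻¹ ^ 2) ∧ ηC p = y)) →
        (∀ p q : E4, p 2 = 0 → p 3 = 0 → q 0 = 0 → q 1 = 0 → ηH p ≠ ηV q) →
        (∀ p : E4, p 2 = 0 → p 3 = 0 → ηH p ≠ ηC 0) →
        (∀ q : E4, q 0 = 0 → q 1 = 0 → ηV q ≠ ηC 0) →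
        ∃ lamV lamH : X → X,
          ContMDiff (𝓡 4) (𝓡 4) ∞ lamV ∧
          ContMDiff (𝓡 4) (𝓡 4) ∞ lamH ∧
          (∀ y : X, (∃ p : E4, p 2 = 0 ∧ p 3 = 0 ∧ ηH p = lamV y) ∨ lamV y = ηC 0) ∧
          (∀ p : E4, p 2 = 0 → p 3 = 0 → lamV (ηH p) = ηH p) ∧
          lamV (ηC 0) = ηC 0 ∧
          (∀ y : X, (∃ q : E4, q 0 = 0 ∧ q 1 = 0 ∧ ηV q = lamH y) ∨ lamH y = ηC 0) ∧
          (∀ q : E4, q 0 = 0 → q 1 = 0 → lamH (ηV q) = ηV q) ∧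
          lamH (ηC 0) = ηC 0 ∧
          (∀ y : X, lamV y = ηC 0 ↔ ((∃ q : E4, q 0 = 0 ∧ q 1 = 0 ∧ ηV q = y) ∨ y = ηC 0)) ∧
          (∀ y : X, lamH y = ηC 0 ↔ ((∃ p : E4, p 2 = 0 ∧ p 3 = 0 ∧ ηH p = y) ∨ y = ηC 0)) ∧
          (∀ y y' : X, lamV y = lamV y' → lamH y = lamH y' → y = y') ∧
          (∀ p q : E4, p 2 = 0 → p 3 = 0 → q 0 = 0 → q 1 = 0 →
            ∃ y : X, lamV y = ηH p ∧ lamH y = ηV q) ∧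
          (∀ (y : X) (v : TangentSpace (𝓡 4) y), mfderiv (𝓡 4) (𝓡 4) lamV y v = 0 →
            mfderiv (𝓡 4) (𝓡 4) lamV y (JX y v) = 0) ∧
          (∀ (y : X) (v : TangentSpace (𝓡 4) y), mfderiv (𝓡 4) (𝓡 4) lamH y v = 0 →
            mfderiv (𝓡 4) (𝓡 4) lamH y (JX y v) = 0) ∧
          (∀ (y : X) (v : TangentSpace (𝓡 4) y), mfderiv (𝓡 4) (𝓡 4) lamV y v = 0 →
            mfderiv (𝓡 4) (𝓡 4) lamH y v = 0 → v = 0) :=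
  stub_coreGlue hF1 hF2 stub_factPositivity hF4 stub_factCountHomological stub_factIndexHomological

/-- **Stub 4 — THE APEX, now a theorem of Stubs 4a–4e (registered signature unchanged):** the
Gromov–McDuff bi-foliation of the wedge cap read on `M`.  Composition: CORE (`lamV`, `lamH`) → wedge
facts → flat leaves (with the analytic lemma) → read `σ`.  See the reshaping note above and the
original statement's docstring in `Lines/cross_cap_laurent.lean` (tree) for (B1)–(B5).
[cite: Wendl2018, Thm 6.8; McDuffSalamon2017, Rem. 4.5.2 (v),(viii); Gromov1985, §0.3.C, 2.4.A₁′] -/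
theorem biFoliation_of_facts
    (hF1 : Literature.Geometry.Symplectic.hls_localFoliation_embeddedSphere_trivialNormal)
    (hF2 : Literature.Geometry.Symplectic.gromovCompactness_spheres_dichotomy)
    (hF4 : Literature.Geometry.Symplectic.adjunction_embedded_of_somewhereInjective_sphere) :
    ∀ (M : Type) [TopologicalSpace M] [T2Space M] [SecondCountableTopology M]
      [ChartedSpace E4 M] [IsManifold (𝓡 4) ∞ M] [ConnectedSpace M]
      (J : AlmostComplexStructure (𝓡 4) ∞ M) (K : Set M) (R R₁ : ℝ) (ψ : M → E4) (χ : E4 → M),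
      (∀ x : M, Subsingleton (π_ 2 M x)) →
      ContMDiffOn (𝓡 4) 𝓘(ℝ, E4) ∞ ψ Kᶜ →
      ContMDiffOn 𝓘(ℝ, E4) (𝓡 4) ∞ χ (Metric.closedBall (0 : E4) R)ᶜ →
      Set.BijOn ψ Kᶜ (Metric.closedBall (0 : E4) R)ᶜ →
      (∀ x, x ∈ Kᶜ → χ (ψ x) = x) →
      R < R₁ → 0 < R₁ →
      (∀ x, x ∈ Kᶜ → R₁ < ‖ψ x‖ → ∀ (v : TangentSpace (𝓡 4) x) (a : E4),
          a = mfderiv (𝓡 4) 𝓘(ℝ, E4) ψ x v →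
          mfderiv (𝓡 4) 𝓘(ℝ, E4) ψ x (J x v) = WithLp.toLp 2 ![-(a 1), a 0, -(a 3), a 2]) →
      ∀ (X : Type) [TopologicalSpace X] [T2Space X] [SecondCountableTopology X] [CompactSpace X]
        [ConnectedSpace X] [ChartedSpace E4 X] [IsManifold (𝓡 4) ∞ X]
        (ωX : MForm (𝓡 4) X ℝ 2) (JX : AlmostComplexStructure (𝓡 4) ∞ X) (ι : M → X)
        (ηH ηV ηC : E4 → X),
        (IsSmoothForm ωX ∧ IsClosedForm ωX ∧ JX.IsTamedBy ωX) ∧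
        (IsLocalDiffeomorph (𝓡 4) (𝓡 4) ∞ ι ∧ Function.Injective ι ∧
          ∀ (x : M) (v : TangentSpace (𝓡 4) x),
            JX (ι x) (mfderiv (𝓡 4) (𝓡 4) ι x v) = mfderiv (𝓡 4) (𝓡 4) ι x (J x v)) ∧
        (IsLocalDiffeomorphOn 𝓘(ℝ, E4) (𝓡 4) ∞ ηV {p : E4 | p 0 ^ 2 + p 1 ^ 2 < R₁⁻¹ ^ 2} ∧
          Set.InjOn ηV {p : E4 | p 0 ^ 2 + p 1 ^ 2 < R₁⁻¹ ^ 2} ∧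
          (∀ p : E4, p 0 ^ 2 + p 1 ^ 2 < R₁⁻¹ ^ 2 → (p 0 ≠ 0 ∨ p 1 ≠ 0) →
            ηV p = ι (χ (WithLp.toLp 2
              ![p 0 / (p 0 ^ 2 + p 1 ^ 2), -(p 1) / (p 0 ^ 2 + p 1 ^ 2), p 2, p 3]))) ∧
          (∀ p : E4, p 0 = 0 → p 1 = 0 → ηV p ∉ Set.range ι) ∧
          (∀ p : E4, p 0 ^ 2 + p 1 ^ 2 < R₁⁻¹ ^ 2 → ∀ q : E4,
            JX (ηV p) (mfderiv 𝓘(ℝ, E4) (𝓡 4) ηV p q) =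
              mfderiv 𝓘(ℝ, E4) (𝓡 4) ηV p (WithLp.toLp 2 ![-(q 1), q 0, -(q 3), q 2]))) ∧
        (IsLocalDiffeomorphOn 𝓘(ℝ, E4) (𝓡 4) ∞ ηH {p : E4 | p 2 ^ 2 + p 3 ^ 2 < R₁⁻¹ ^ 2} ∧
          Set.InjOn ηH {p : E4 | p 2 ^ 2 + p 3 ^ 2 < R₁⁻¹ ^ 2} ∧
          (∀ p : E4, p 2 ^ 2 + p 3 ^ 2 < R₁⁻¹ ^ 2 → (p 2 ≠ 0 ∨ p 3 ≠ 0) →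
            ηH p = ι (χ (WithLp.toLp 2
              ![p 0, p 1, p 2 / (p 2 ^ 2 + p 3 ^ 2), -(p 3) / (p 2 ^ 2 + p 3 ^ 2)]))) ∧
          (∀ p : E4, p 2 = 0 → p 3 = 0 → ηH p ∉ Set.range ι) ∧
          (∀ p : E4, p 2 ^ 2 + p 3 ^ 2 < R₁⁻¹ ^ 2 → ∀ q : E4,
            JX (ηH p) (mfderiv 𝓘(ℝ, E4) (𝓡 4) ηH p q) =
              mfderiv 𝓘(ℝ, E4) (𝓡 4) ηH p (WithLp.toLp 2 ![-(q 1), q 0, -(q 3), q 2]))) ∧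
        (IsLocalDiffeomorphOn 𝓘(ℝ, E4) (𝓡 4) ∞ ηC
            {p : E4 | p 0 ^ 2 + p 1 ^ 2 < R₁⁻¹ ^ 2 ∧ p 2 ^ 2 + p 3 ^ 2 < R₁⁻¹ ^ 2} ∧
          Set.InjOn ηC {p : E4 | p 0 ^ 2 + p 1 ^ 2 < R₁⁻¹ ^ 2 ∧ p 2 ^ 2 + p 3 ^ 2 < R₁⁻¹ ^ 2} ∧
          (∀ p : E4, p 0 ^ 2 + p 1 ^ 2 < R₁⁻¹ ^ 2 → p 2 ^ 2 + p 3 ^ 2 < R₁⁻¹ ^ 2 →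
            (p 2 ≠ 0 ∨ p 3 ≠ 0) →
            ηC p = ηV (WithLp.toLp 2
              ![p 0, p 1, p 2 / (p 2 ^ 2 + p 3 ^ 2), -(p 3) / (p 2 ^ 2 + p 3 ^ 2)])) ∧
          (∀ p : E4, p 0 ^ 2 + p 1 ^ 2 < R₁⁻¹ ^ 2 → p 2 ^ 2 + p 3 ^ 2 < R₁⁻¹ ^ 2 →
            (p 0 ≠ 0 ∨ p 1 ≠ 0) →
            ηC p = ηH (WithLp.toLp 2
              ![p 0 / (p 0 ^ 2 + p 1 ^ 2), -(p 1) / (p 0 ^ 2 + p 1 ^ 2), p 2, p 3])) ∧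
          ηC 0 ∉ Set.range ι ∧
          (∀ p : E4, p 0 ^ 2 + p 1 ^ 2 < R₁⁻¹ ^ 2 → p 2 ^ 2 + p 3 ^ 2 < R₁⁻¹ ^ 2 → ∀ q : E4,
            JX (ηC p) (mfderiv 𝓘(ℝ, E4) (𝓡 4) ηC p q) =
              mfderiv 𝓘(ℝ, E4) (𝓡 4) ηC p (WithLp.toLp 2 ![-(q 1), q 0, -(q 3), q 2]))) ∧
        (∀ y : X, y ∈ Set.range ι ∨ (∃ p : E4, p 0 ^ 2 + p 1 ^ 2 < R₁⁻¹ ^ 2 ∧ ηV p = y) ∨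
          (∃ p : E4, p 2 ^ 2 + p 3 ^ 2 < R₁⁻¹ ^ 2 ∧ ηH p = y) ∨
          (∃ p : E4, (p 0 ^ 2 + p 1 ^ 2 < R₁⁻¹ ^ 2 ∧ p 2 ^ 2 + p 3 ^ 2 < R₁⁻¹ ^ 2) ∧ ηC p = y)) →
        ∃ σ : M ≃ₘ⟮𝓡 4, 𝓡 4⟯ E4,
          (∀ (x : M) (v : TangentSpace (𝓡 4) x) (a b : E4), a = mfderiv (𝓡 4) 𝓘(ℝ, E4) σ x v →
              b = mfderiv (𝓡 4) 𝓘(ℝ, E4) σ x (J x v) →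
              (a 2 = 0 → a 3 = 0 → b 2 = 0 ∧ b 3 = 0) ∧ (a 0 = 0 → a 1 = 0 → b 0 = 0 ∧ b 1 = 0)) ∧
          (∀ (x : M) (v : TangentSpace (𝓡 4) x), v ≠ 0 →
              0 < stdSymplecticForm (mfderiv (𝓡 4) 𝓘(ℝ, E4) σ x v)
                (mfderiv (𝓡 4) 𝓘(ℝ, E4) σ x (J x v))) ∧
          (∀ w : E4, R₁ ^ 2 < w 0 ^ 2 + w 1 ^ 2 → (σ (χ w)) 0 = w 0 ∧ (σ (χ w)) 1 = w 1) ∧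
          (∀ w : E4, R₁ ^ 2 < w 2 ^ 2 + w 3 ^ 2 → (σ (χ w)) 2 = w 2 ∧ (σ (χ w)) 3 = w 3) ∧
          (∃ g : E4 → E2, ContDiffOn ℝ ∞ g {p : E4 | p 0 ^ 2 + p 1 ^ 2 < R₁⁻¹ ^ 2} ∧
            (∀ p q : E4, p 0 ^ 2 + p 1 ^ 2 < R₁⁻¹ ^ 2 → (p 0 ≠ 0 ∨ p 1 ≠ 0) →
              q = σ (χ (WithLp.toLp 2
                ![p 0 / (p 0 ^ 2 + p 1 ^ 2), -(p 1) / (p 0 ^ 2 + p 1 ^ 2), p 2, p 3])) →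
              g p = WithLp.toLp 2 ![q 2, q 3]) ∧
            (∀ p : E4, p 0 = 0 → p 1 = 0 → g p = WithLp.toLp 2 ![p 2, p 3])) ∧
          (∃ h : E4 → E2, ContDiffOn ℝ ∞ h {p : E4 | p 2 ^ 2 + p 3 ^ 2 < R₁⁻¹ ^ 2} ∧
            (∀ p q : E4, p 2 ^ 2 + p 3 ^ 2 < R₁⁻¹ ^ 2 → (p 2 ≠ 0 ∨ p 3 ≠ 0) →
              q = σ (χ (WithLp.toLp 2
                ![p 0, p 1, p 2 / (p 2 ^ 2 + p 3 ^ 2), -(p 3) / (p 2 ^ 2 + p 3 ^ 2)])) →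
              h p = WithLp.toLp 2 ![q 0, q 1]) ∧
            (∀ p : E4, p 2 = 0 → p 3 = 0 → h p = WithLp.toLp 2 ![p 0, p 1])) := by
  intro M _ _ _ _ _ _ J K R R₁ ψ χ h1 h6 h7 h8 h9 hR₁ hR₁pos hJstd X _ _ _ _ _ _ _ ωX JX ι ηH ηV ηC hW
  obtain ⟨hwHV, hwH, hwV⟩ :=
    stub_wedgeDisjoint M J K R R₁ ψ χ h6 h7 h8 h9 hR₁ hR₁pos hJstd X ωX JX ι ηH ηV ηC hW
  obtain ⟨lamV, lamH, hsV, hsH, hinH, hrH, hrHc, hinV, hrV, hrVc, hcV, hcH, hinj, hsurj, hJV, hJH, htr⟩ :=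
    biFoliationCore_of_facts hF1 hF2 hF4 M J R₁ χ h1 hR₁pos X ωX JX ι ηH ηV ηC hW hwHV hwH hwV
  obtain ⟨hoV, hoH⟩ :=
    stub_positiveHolonomy M J K R R₁ ψ χ h6 h7 h8 h9 hR₁ hR₁pos hJstd X ωX JX ι ηH ηV ηC hW lamV lamH
      hsV hsH hinH hrH hrHc hinV hrV hrVc hcV hcH hJV hJH htr
  obtain ⟨hfV, hfH⟩ :=
    stub_flatLeaves M J K R R₁ ψ χ h6 h7 h8 h9 hR₁ hR₁pos hJstd X ωX JX ι ηH ηV ηC hW lamV lamH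
      hsV hsH hinH hrH hinV hrV hcV hcH hJV hJH hoV hoH stub_sphereDetVanishes
  exact stub_readSigma M J K R R₁ ψ χ h6 h7 h8 h9 hR₁ hR₁pos hJstd X ωX JX ι ηH ηV ηC hW lamV lamH
    hsV hsH hinH hrH hrHc hinV hrV hrVc hcV hcH hinj hsurj hJV hJH htr hoV hoH hwHV hwH hwV hfV hfH


/-- **The line concludes the crux BY NAME.**  Stub 1 (end does not return) → Stub 2 (tame `J`,
integrable on a sub-end, `R₁ > max R 0`) → Stub 3 (wedge cap `X`) → Stub 4 (APEX: bi-foliation chart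
`σ`, using `π₂(M) = 0` here only) → Stub 5 (decay + tame cut-off `Φ₁ = ψ` off compact `K₁ ⊇ K`) →
Stub 6 (compactly supported tame Moser) = the crux's conclusion.  Pure logic: the ten crux hypotheses
are threaded to the stubs that consume them (H1 → Stub 4; H2 → 1,2,3,6; H3 → 3,6; H4 → 2,3;
H5 → 1,2,3,5; H6/H8 → 1,2,3,4,5; H7/H9 → 1,3,4,5; H10 → 1,2,3,5 and, off `K₁ ⊇ K`, 6). -/
theorem helper_cruxOfFacts :
    Literature.Geometry.Symplectic.hls_localFoliation_embeddedSphere_trivialNormal →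
    Literature.Geometry.Symplectic.gromovCompactness_spheres_dichotomy →
    Literature.Geometry.Symplectic.adjunction_embedded_of_somewhereInjective_sphere →
    Summit.SmoothPoincare4.SmoothPoincare4.Theses.SymplecticOrigami.GromovRecognitionRelEnd := by
  intro hF1 hF2 hF4 M _ _ _ _ _ _ sf K R ψ χ h1 h2 h3 h4 h5 h6 h7 h8 h9 h10
  -- Stub 1: the truncations are open
  have hopen : ∀ R', R < R' → IsOpen (K ∪ {x | x ∈ Kᶜ ∧ ‖ψ x‖ < R'}) :=
    stub_endDoesNotReturn M sf K R ψ χ h2 h5 h6 h7 h8 h9 h10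
  -- Stub 2: a tame `J`, integrable beyond `R₁`
  obtain ⟨R₁, J, hR₁, hR₁pos, hJt, hJstd⟩ := stub_tameJ M sf K R ψ h2 h4 h5 h6 h8 h10 hopen
  -- Stub 3: the wedge cap
  obtain ⟨X, _, _, _, _, _, _, _, ωX, JX, ι, ηH, ηV, ηC, hW⟩ :=
    stub_capModel M sf K R ψ χ h2 h3 h4 h5 h6 h7 h8 h9 h10 hopen R₁ J hR₁ hR₁pos hJt hJstd
  -- Stub 4 (apex): the bi-foliation chart
  obtain ⟨σ, hB1, hB2, hB3a, hB3b, hB4, hB5⟩ :=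
    biFoliation_of_facts hF1 hF2 hF4 M J K R R₁ ψ χ h1 h6 h7 h8 h9 hR₁ hR₁pos hJstd X ωX JX ι ηH ηV ηC hW
  -- Stub 5: decay + tame cut-off
  obtain ⟨Φ₁, K₁, hK₁, hKK₁, hΦψ, htame⟩ :=
    stub_flatCutoff M sf K R ψ χ h5 h6 h7 h8 h9 h10 R₁ J hR₁ hR₁pos hJt hJstd σ
      hB1 hB2 hB3a hB3b hB4 hB5
  -- Stub 6: compactly supported tame Moser
  exact stub_tameMoser M sf J K₁ ψ Φ₁ h2 h3 hK₁ hΦψ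
    (fun x hx v w => h10 x (fun hxK => hx (hKK₁ hxK)) v w) hJt htame


/-- **The crux (SymplecticOrigami copy) from the three remaining facts** — descriptive alias of the
registered `helper_cruxOfFacts`. -/
theorem GromovRecognitionRelEnd_of_facts :
    Literature.Geometry.Symplectic.hls_localFoliation_embeddedSphere_trivialNormal →
    Literature.Geometry.Symplectic.gromovCompactness_spheres_dichotomy →
    Literature.Geometry.Symplectic.adjunction_embedded_of_somewhereInjective_sphere →
    Summit.SmoothPoincare4.SmoothPoincare4.Theses.SymplecticOrigami.GromovRecognitionRelEnd :=
  helper_cruxOfFacts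

/-- **The SymplecticCap copy of the crux from the three facts** (the two route decls have identical
bodies). -/
theorem GromovRecognitionRelEnd_cap_of_facts :
    Literature.Geometry.Symplectic.hls_localFoliation_embeddedSphere_trivialNormal →
    Literature.Geometry.Symplectic.gromovCompactness_spheres_dichotomy →
    Literature.Geometry.Symplectic.adjunction_embedded_of_somewhereInjective_sphere →
    Summit.SmoothPoincare4.SmoothPoincare4.Theses.SymplecticCap.GromovRecognitionRelEnd :=
  GromovRecognitionRelEnd_of_facts

end Summit.SmoothPoincare4.SmoothPoincare4.Theorems.GromovRecognitionRelEnd.CrossCapLaurent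

end
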